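import Literature.NumberTheory.LFunctions.SonineExtendedMellinContinuation
import Literature.NumberTheory.LFunctions.BurnolSonineFourier
import Literature.NumberTheory.LFunctions.BurnolZetaSystemsHardy
import Literature.Analysis.SpecialFunctions.GammaStirlingVertical
import Literature.Analysis.SpecialFunctions.GammaStirlingOrder
import HarnessLib

/-!
# Burnol 2004b, Lemma 4.10: the dense subspace `𝓛₁ ⊂ L_1` is stable under the cosine transform `𝓕₊`

LINE 1 — LABEL: RH-FREE (Fourier/Mellin analysis of even `L²` functions constant on `(−1,1)` together
with their cosine transform; the Riemann zeta function does not occur). FRAMING (cell rh-crit, D-0074):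
corpus theorems are RH-FREE literature; nothing here is worded as progress toward RH. bears_on: B-C/B-P
(LADDER-RH COLUMN 6, de Branges framework) — this is the bookkeeping lemma used in [Burnol2004b, §5]
(Thm. 5.2, Prop. 5.4: the residue expansions are stated for `G ∈ 𝓛̂₁` AND for `𝓕₊G`). WHAT THIS IS NOT:
not a route, not a criterion; discharging an as-printed structural lemma fixes corpus vocabulary and moves
RH by nothing. Nothing here bears on the truth of RH.

Source. J.-F. Burnol, *Two complete and minimal systems associated with the zeros of the Riemann zeta
function*, J. Théor. Nombres Bordeaux **16** (2004) 65–94 = arXiv:math/0203120v7 [Burnol2004b], §4,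
Lemma 4.10 (TeX of record `rh-crit/dbl/src/Burnol2004JTNB_arXivmath0203120v7.tex` l.947–951):

> **Lemma 4.10.** The subspace `𝓛₁` is stable under `𝓕₊`.
> *Proof.* Clear from the estimates of `χ(s)` in vertical strips ([Titchmarsh1986, IV.12.3]).

Here `𝓛₁ ⊂ L_1` is the sub-vector space of the functions `g` whose (continued) right Mellin transforms
`G(s) = ĝ(s)` are `O_{a,b,N}(|s|^{−N})` on every vertical strip `a ≤ Re s ≤ b`, away from the pole at
`s = 1` (tree: `Literature.NumberTheory.LFunctions.burnolScriptL1`, typed with "away from the pole" as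
`|Im s| ≥ 1`), and `χ(s) = Γ_ℝ(1−s)/Γ_ℝ(s)` is the factor of the functional equation
`ζ(s) = χ(s)ζ(1−s)` ([Titchmarsh1986, (2.1.10), (4.12.3)]: `|χ(s)| ≍ (|t|/2π)^{1/2−σ}` in any fixed
strip).

## What is PROVED (theorem-only module: no definition, no new named fact; net debt −1)

* `Burnol2004b_lemma4_10_holds : Burnol2004b_lemma4_10` — the DISCHARGE of the named fact of
  `BurnolZetaSystemsHardy.lean`.
* `BurnolScriptL1.exists_norm_Gammaℝ_one_sub_div_le` — the estimate of `χ(s)` in vertical strips in the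
  form used: for real `a ≤ … ≤ b` there is `K` with `‖Γ_ℝ(1−s)/Γ_ℝ(s)‖ ≤ K |Im s|^{1/2 − Re s}` whenever
  `a ≤ Re s ≤ b`, `|Im s| ≥ 1` (reusable by the §5 rows).

## The printed proof and how it is followed

Exactly as printed, with the tree's inputs:

1. `𝓕₊g ∈ L_1` for `g ∈ L_1` (`fourier_mem_sonineL`, the definition of `L_a` being symmetric under the
   involution `𝓕₊`).
2. The functional equation `Γ_ℝ(s)·(𝓕₊g)^(s) = Γ_ℝ(1−s)·ĝ(1−s)` off the poles (`s ∉ −2ℕ`,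
   `s ∉ 1 + 2ℕ`, automatic when `Im s ≠ 0`) — Burnol 2004b Prop. 2.2 (v), the tree theorem
   `SonineLContinuation.rightMellinExt_functionalEquation_of_mem_sonineL` (dbl-t14 g3,
   `SonineExtendedMellinContinuation.lean`); hence `(𝓕₊g)^(s) = χ(s)·ĝ(1−s)`.
3. "The estimates of `χ(s)` in vertical strips": from Mathlib's
   `Γ_ℝ(s)/Γ_ℝ(1−s) = Γ_ℂ(s)cos(πs/2)` (`Gammaℝ_div_Gammaℝ_one_sub`), the tree's uniform Stirling LOWER
   bound `‖Γ(σ+it)‖ ≥ c|t|^{σ−1/2}e^{−π|t|/2}` for `σ ∈ [a,b]`, `|t| ≥ 1`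
   (`Literature.Analysis.SpecialFunctions.GammaStirling.exists_norm_Gamma_vertical_ge`) and
   `‖cos(πs/2)‖ ≥ |sinh(πt/2)| ≥ e^{π|t|/2}/4` (`abs_sinh_im_le_norm_cos`, `exp_le_four_mul_sinh`):
   `‖χ(s)‖ ≤ (2/c)(2π)^{σ}|t|^{1/2−σ}`.
4. Transfer of the decay: on `a ≤ Re s ≤ b`, `|Im s| ≥ 1`, with `m ∈ ℕ`, `m ≥ 1/2 − a`,
   `‖(𝓕₊g)^(s)‖ ≤ K|t|^{1/2−σ}·C‖1−s‖^{−N−m} ≤ KC‖1−s‖^{−N} ≤ KC·L^N‖s‖^{−N}`,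
   `L = max(|a|,|b|) + 1` (as `|t| ≤ ‖1−s‖` and `‖s‖ ≤ L|t|`), using the hypothesis for `g` on the
   reflected strip `1−b ≤ Re s ≤ 1−a` with exponent `N + m`.

## References
* [Burnol2004b] J.-F. Burnol, JTNB 16 (2004) = arXiv:math/0203120v7, §4 Lemma 4.10 (p. 11, TeX l.947–951),
  Prop. 2.2 (p. 5, TeX l.460–469).
* [Titchmarsh1986] E. C. Titchmarsh, *The Theory of the Riemann Zeta-Function*, 2nd ed., OUP 1986,
  §2.1 (2.1.10) and §4.12 (4.12.3).
-/

noncomputable section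

open MeasureTheory Complex Filter Set
open scoped Real Topology FourierTransform

namespace Literature.NumberTheory.LFunctions

namespace BurnolScriptL1

open Literature.Analysis.SpecialFunctions

/-! ### The estimate of `χ(s) = Γ_ℝ(1−s)/Γ_ℝ(s)` in vertical strips (Titchmarsh (4.12.3), upper half) -/

/-- `|sinh x| = sinh |x|`. [folklore] -/
private theorem abs_sinh_eq_sinh_abs (x : ℝ) : |Real.sinh x| = Real.sinh |x| := by
  rcases le_or_gt 0 x with h | h
  · rw [abs_of_nonneg h, abs_of_nonneg (Real.sinh_nonneg_iff.2 h)]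
  · rw [abs_of_neg h, abs_of_neg (Real.sinh_neg_iff.2 h), ← Real.sinh_neg]

/-- `‖cos(πs/2)‖ ≥ e^{π|Im s|/2}/4` for `|Im s| ≥ 1` (`‖cos z‖ ≥ |sinh(Im z)|` and `e^u ≤ 4 sinh u` for
`u ≥ 1/2`). [cite: Titchmarsh1986, §4.12 eq. (4.12.3)] -/
theorem exp_div_four_le_norm_cos {s : ℂ} (hs : 1 ≤ |s.im|) :
    Real.exp (π * |s.im| / 2) / 4 ≤ ‖Complex.cos (π * s / 2)‖ := by
  have h1 := abs_sinh_im_le_norm_cos (π * s / 2)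
  have him : (π * s / 2 : ℂ).im = π * s.im / 2 := by
    simp [mul_im]
  rw [him, abs_sinh_eq_sinh_abs, show |π * s.im / 2| = π * |s.im| / 2 by
    rw [abs_div, abs_mul, abs_of_pos Real.pi_pos, abs_of_pos (by norm_num : (0 : ℝ) < 2)]] at h1
  have h2 : Real.exp (π * |s.im| / 2) ≤ 4 * Real.sinh (π * |s.im| / 2) :=
    exp_le_four_mul_sinh (by nlinarith [Real.pi_gt_three])
  linarith

/-- **Titchmarsh (4.12.3), upper half, uniformly in a strip**: for real `a, b` there is `K > 0` such that
`‖Γ_ℝ(1−s)/Γ_ℝ(s)‖ ≤ K |Im s|^{1/2 − Re s}` whenever `a ≤ Re s ≤ b` and `|Im s| ≥ 1`. Proof: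
`Γ_ℝ(1−s)/Γ_ℝ(s) = (Γ_ℂ(s)cos(πs/2))^{-1}` (Mathlib `Gammaℝ_div_Gammaℝ_one_sub`), `Γ_ℂ(s) = 2(2π)^{−s}Γ(s)`,
the uniform Stirling lower bound `‖Γ(σ+it)‖ ≥ c|t|^{σ−1/2}e^{−π|t|/2}` of the tree
(`GammaStirling.exists_norm_Gamma_vertical_ge`) and `‖cos(πs/2)‖ ≥ e^{π|t|/2}/4`.
[cite: Titchmarsh1986, §4.12 eq. (4.12.3)] -/
theorem exists_norm_Gammaℝ_one_sub_div_le (a b : ℝ) :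
    ∃ K : ℝ, 0 < K ∧ ∀ s : ℂ, a ≤ s.re → s.re ≤ b → 1 ≤ |s.im| →
      ‖Gammaℝ (1 - s) / Gammaℝ s‖ ≤ K * |s.im| ^ (1 / 2 - s.re) := by
  obtain ⟨c, hc, hΓ⟩ := GammaStirling.exists_norm_Gamma_vertical_ge a b
  refine ⟨2 / c * (2 * π) ^ b, by positivity, fun s hsa hsb hst ↦ ?_⟩
  have ht0 : 0 < |s.im| := by linarith
  have him : s.im ≠ 0 := abs_pos.mp ht0
  -- `Γ_ℝ(s)/Γ_ℝ(1−s) = Γ_ℂ(s)cos(πs/2)` (Mathlib), inverted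
  have hodd : ∀ n : ℕ, s ≠ -(2 * n + 1) := by
    intro n h
    apply him
    rw [h]
    simp
  have hkey : Gammaℝ (1 - s) / Gammaℝ s = (Gammaℂ s * Complex.cos (π * s / 2))⁻¹ := by
    rw [← Gammaℝ_div_Gammaℝ_one_sub hodd, inv_div]
  -- the two lower bounds
  have hG : c * |s.im| ^ (s.re - 1 / 2) * Real.exp (-(π * |s.im|) / 2) ≤ ‖Complex.Gamma s‖ := by
    have := hΓ s.re ⟨hsa, hsb⟩ s.im hst
    rwa [Complex.re_add_im] at this
  have hcos : Real.exp (π * |s.im| / 2) / 4 ≤ ‖Complex.cos (π * s / 2)‖ := exp_div_four_le_norm_cos hst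
  have h2π : ‖(2 * π : ℂ) ^ (-s)‖ = (2 * π) ^ (-s.re) := by
    rw [show (2 * (π : ℂ)) = ((2 * π : ℝ) : ℂ) by push_cast; ring,
      Complex.norm_cpow_eq_rpow_re_of_pos (by positivity)]
    simp
  have hGC : ‖Gammaℂ s‖ = 2 * (2 * π) ^ (-s.re) * ‖Complex.Gamma s‖ := by
    rw [Gammaℂ_def, norm_mul, norm_mul, h2π, Complex.norm_two]
  have hee : Real.exp (-(π * |s.im|) / 2) * Real.exp (π * |s.im| / 2) = 1 := by
    rw [← Real.exp_add]
    convert Real.exp_zero using 2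
    ring
  have hprod : c / 2 * (2 * π) ^ (-s.re) * |s.im| ^ (s.re - 1 / 2) ≤
      ‖Gammaℂ s * Complex.cos (π * s / 2)‖ := by
    rw [norm_mul, hGC]
    calc c / 2 * (2 * π) ^ (-s.re) * |s.im| ^ (s.re - 1 / 2)
        = c / 2 * (2 * π) ^ (-s.re) * |s.im| ^ (s.re - 1 / 2) *
            (Real.exp (-(π * |s.im|) / 2) * Real.exp (π * |s.im| / 2)) := by rw [hee, mul_one]
      _ = (2 * (2 * π) ^ (-s.re) * (c * |s.im| ^ (s.re - 1 / 2) * Real.exp (-(π * |s.im|) / 2))) *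
            (Real.exp (π * |s.im| / 2) / 4) := by ring
      _ ≤ (2 * (2 * π) ^ (-s.re) * ‖Complex.Gamma s‖) * ‖Complex.cos (π * s / 2)‖ := by
          gcongr
  have hlow_pos : 0 < c / 2 * (2 * π) ^ (-s.re) * |s.im| ^ (s.re - 1 / 2) := by positivity
  have hπσ : (2 * π) ^ s.re ≠ 0 := (Real.rpow_pos_of_pos (by positivity) _).ne'
  have htσ : |s.im| ^ (1 / 2 - s.re) ≠ 0 := (Real.rpow_pos_of_pos ht0 _).ne'
  rw [hkey, norm_inv]
  calc ‖Gammaℂ s * Complex.cos (π * s / 2)‖⁻¹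
      ≤ (c / 2 * (2 * π) ^ (-s.re) * |s.im| ^ (s.re - 1 / 2))⁻¹ := inv_anti₀ hlow_pos hprod
    _ = 2 / c * (2 * π) ^ s.re * |s.im| ^ (1 / 2 - s.re) := by
        rw [Real.rpow_neg (by positivity) s.re, show s.re - 1 / 2 = -(1 / 2 - s.re) by ring,
          Real.rpow_neg ht0.le]
        field_simp
    _ ≤ 2 / c * (2 * π) ^ b * |s.im| ^ (1 / 2 - s.re) := by
        have h2π1 : (1 : ℝ) ≤ 2 * π := by linarith [Real.pi_gt_three]
        have hmono : (2 * π) ^ s.re ≤ (2 * π) ^ b := Real.rpow_le_rpow_of_exponent_le h2π1 hsb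
        gcongr

end BurnolScriptL1

/-! ### Lemma 4.10 -/

/-- **Burnol 2004b, Lemma 4.10, PROVED**: "The subspace `𝓛₁` is stable under `𝓕₊`" — discharge of the
named fact `Burnol2004b_lemma4_10`. Printed proof ("Clear from the estimates of `χ(s)` in vertical strips"):
`𝓕₊g ∈ L_1` (`fourier_mem_sonineL`); the functional equation of Prop. 2.2,
`(𝓕₊g)^(s) = Γ_ℝ(1−s)/Γ_ℝ(s) · ĝ(1−s)` off the poles
(`SonineLContinuation.rightMellinExt_functionalEquation_of_mem_sonineL`); and
`‖Γ_ℝ(1−s)/Γ_ℝ(s)‖ ≤ K|t|^{1/2−σ}` (`BurnolScriptL1.exists_norm_Gammaℝ_one_sub_div_le`) transfer the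
rapid decay of `ĝ` on the reflected strip (exponent `N + m`, `m ≥ 1/2 − a`) to `(𝓕₊g)^` (exponent `N`).
[cite: Burnol2004b, Lemma 4.10 (arXiv:math/0203120v7 p. 11, TeX l.947–951)] -/
theorem Burnol2004b_lemma4_10_holds : Burnol2004b_lemma4_10 := by
  intro g hg
  obtain ⟨hgL, hdec⟩ := hg
  refine ⟨fourier_mem_sonineL hgL, fun a b N ↦ ?_⟩
  obtain ⟨K, hK0, hK⟩ := BurnolScriptL1.exists_norm_Gammaℝ_one_sub_div_le a b
  -- a natural exponent dominating `1/2 − Re s` on the strip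
  obtain ⟨m, hm⟩ : ∃ m : ℕ, 1 / 2 - a ≤ m := exists_nat_ge (1 / 2 - a)
  -- the hypothesis for `g` on the reflected strip, with exponent `N + m`
  obtain ⟨C, hC⟩ := hdec (1 - b) (1 - a) (N + m)
  set C₀ : ℝ := max C 0 with hC₀
  set L : ℝ := max |a| |b| + 1 with hL
  have hL0 : 0 ≤ L := by positivity
  refine ⟨K * C₀ * L ^ N, fun s hsa hsb hst ↦ ?_⟩
  have ht0 : 0 < |s.im| := by linarith
  have him : s.im ≠ 0 := abs_pos.mp ht0
  -- pole conditions (automatic off the real axis)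
  have hs0 : ∀ n : ℕ, s ≠ -2 * (n : ℂ) := by
    intro n h
    apply him
    rw [h]
    simp
  have hs1 : ∀ n : ℕ, s ≠ 1 + 2 * (n : ℂ) := by
    intro n h
    apply him
    rw [h]
    simp
  have hΓ : Gammaℝ s ≠ 0 := by
    rw [Ne, Gammaℝ_eq_zero_iff]
    rintro ⟨n, hn⟩
    apply him
    rw [hn]
    simp
  -- the functional equation (Prop. 2.2 (v)), solved for the transform of `𝓕₊g`
  have hFE := SonineLContinuation.rightMellinExt_functionalEquation_of_mem_sonineL one_pos hgL s hs0 hs1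
  have hG : rightMellinExt ((𝓕 g : Lp ℂ 2 (volume : Measure ℝ)) : ℝ → ℂ) s =
      Gammaℝ (1 - s) / Gammaℝ s * rightMellinExt (g : ℝ → ℂ) (1 - s) := by
    rw [div_mul_eq_mul_div, eq_div_iff hΓ, mul_comm]
    exact hFE
  -- bookkeeping on `s` and `1 − s`
  have h1s_re : (1 - s).re = 1 - s.re := by simp
  have h1s_im : |(1 - s).im| = |s.im| := by simp [abs_neg]
  have ht_le : |s.im| ≤ ‖1 - s‖ := by
    have := Complex.abs_im_le_norm (1 - s)
    rwa [h1s_im] at this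
  have h1s_pos : 0 < ‖1 - s‖ := lt_of_lt_of_le ht0 ht_le
  have hs_pos : 0 < ‖s‖ := lt_of_lt_of_le ht0 (Complex.abs_im_le_norm s)
  have hs_le : ‖s‖ ≤ L * ‖1 - s‖ := by
    have hM0 : 0 ≤ max |a| |b| := le_max_of_le_left (abs_nonneg a)
    calc ‖s‖ ≤ |s.re| + |s.im| := Complex.norm_le_abs_re_add_abs_im s
      _ ≤ max |a| |b| + |s.im| := by
          gcongr
          exact abs_le_max_abs_abs hsa hsb
      _ ≤ (max |a| |b| + 1) * |s.im| := by nlinarith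
      _ ≤ L * ‖1 - s‖ := by rw [hL]; gcongr
  -- the hypothesis for `g` at `1 − s`
  have hdec' := hC (1 - s) (by rw [h1s_re]; linarith) (by rw [h1s_re]; linarith)
    (by rw [h1s_im]; exact hst)
  have hGg : ‖rightMellinExt (g : ℝ → ℂ) (1 - s)‖ ≤ C₀ * ‖1 - s‖ ^ (-((N + m : ℕ) : ℝ)) :=
    hdec'.trans (by gcongr; exact le_max_left _ _)
  -- the `χ`-estimate and the exponent bookkeeping
  have hχ := hK s hsa hsb hst
  have hexp : |s.im| ^ (1 / 2 - s.re) ≤ ‖1 - s‖ ^ (m : ℝ) :=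
    calc |s.im| ^ (1 / 2 - s.re) ≤ |s.im| ^ (m : ℝ) :=
          Real.rpow_le_rpow_of_exponent_le hst (by linarith)
      _ ≤ ‖1 - s‖ ^ (m : ℝ) := Real.rpow_le_rpow ht0.le ht_le (Nat.cast_nonneg m)
  have hsplit : ‖1 - s‖ ^ (-((N + m : ℕ) : ℝ)) =
      ‖1 - s‖ ^ (-(N : ℝ)) * (‖1 - s‖ ^ (m : ℝ))⁻¹ := by
    rw [Nat.cast_add, neg_add, Real.rpow_add h1s_pos, Real.rpow_neg h1s_pos.le (m : ℝ)]
  have hsN : ‖1 - s‖ ^ (-(N : ℝ)) ≤ L ^ N * ‖s‖ ^ (-(N : ℝ)) := by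
    rw [Real.rpow_neg h1s_pos.le, Real.rpow_neg hs_pos.le, Real.rpow_natCast, Real.rpow_natCast,
      ← div_eq_mul_inv, le_div_iff₀ (pow_pos hs_pos N)]
    calc (‖1 - s‖ ^ N)⁻¹ * ‖s‖ ^ N ≤ (‖1 - s‖ ^ N)⁻¹ * (L * ‖1 - s‖) ^ N := by gcongr
      _ = L ^ N := by
          rw [mul_pow]
          field_simp
  -- assemble
  rw [hG, norm_mul]
  calc ‖Gammaℝ (1 - s) / Gammaℝ s‖ * ‖rightMellinExt (g : ℝ → ℂ) (1 - s)‖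
      ≤ (K * |s.im| ^ (1 / 2 - s.re)) * (C₀ * ‖1 - s‖ ^ (-((N + m : ℕ) : ℝ))) :=
        mul_le_mul hχ hGg (norm_nonneg _) (by positivity)
    _ = K * C₀ * (|s.im| ^ (1 / 2 - s.re) * (‖1 - s‖ ^ (m : ℝ))⁻¹) * ‖1 - s‖ ^ (-(N : ℝ)) := by
        rw [hsplit]
        ring
    _ ≤ K * C₀ * 1 * ‖1 - s‖ ^ (-(N : ℝ)) := by
        gcongr
        rw [mul_inv_le_iff₀ (Real.rpow_pos_of_pos h1s_pos _), one_mul]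
        exact hexp
    _ ≤ K * C₀ * 1 * (L ^ N * ‖s‖ ^ (-(N : ℝ))) := by gcongr
    _ = K * C₀ * L ^ N * ‖s‖ ^ (-(N : ℝ)) := by ring

end Literature.NumberTheory.LFunctions

end
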